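import Mathlib.Topology.Constructions
import Literature.NumberTheory.EllipticCurves.IwasawaSelmerDualProofs
import Literature.NumberTheory.EllipticCurves.SelmerInftyTorsionFiniteProofs
import Literature.NumberTheory.EllipticCurves.ZpExtensionUnramifiedProofs
import HarnessLib

/-!
# Crux `PlecticRankUB` (stmt-BirchSwinnertonDyer-17519), line
# `heegner-leading-form-plectic-certificate` — stub P `stub_lineData`: lines of a `ℤ_p^n`-tower are
# `ℤ_p`-extensions with a topological generator and a finitely generated Selmer dual datum

Registered stub P ("line data"; known mathematics) of the skeleton of line
`heegner-leading-form-plectic-certificate` (route `PlecticLegs`, crux #3,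
`Summit.BirchSwinnertonDyer.BirchSwinnertonDyer.Theses.PlecticLegs.PlecticRankUB`).

Let `K` be a number field, `p` a prime and `Φ₁, …, Φ_n : Γ_K →ₜ* ℤ_p` continuous characters of the
absolute Galois group `Γ_K = Field.absoluteGaloisGroup K` which are *jointly surjective*
(`σ ↦ (Φ_i σ)_i : Γ_K → ℤ_p^n` is onto; they cut out a `ℤ_p^n`-tower of `K`).  For an integral
direction `a ∈ ℕ^n` with some `aᵢ` prime to `p`, the **line of direction `a`** is the character
`κ = ∑ aᵢ Φᵢ : Γ_K →ₜ* ℤ_p`.  The stub asserts: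

1. `κ` is surjective, i.e. a `ℤ_p`-extension of `K` in the tree's choice-free sense
   (`Literature.NumberTheory.EllipticCurves.ZpExtension K p`), with
   `(κ σ) = ∑ aᵢ Φᵢ(σ)` for all `σ`;
2. `κ` has a topological generator `γ` (`κ γ = 1 ∈ ℤ_p`, `ZpExtension.IsTopGenerator`);
3. for every elliptic curve `W/K` the Pontryagin dual of `Sel_{p^∞}(W/K_∞)` carries a `Λ`-module
   structure with `T = γ - 1` (a `WeierstrassCurve.SelmerDualData W κ γ`) which is finitely
   generated over `Λ = ℤ_p⟦T⟧`.

## Proof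

(1) `σ ↦ ∑ aᵢ Φᵢ(σ)` is a continuous homomorphism (finite sum of continuous homomorphisms into the
topological ring `ℤ_p`).  Surjectivity: pick `i₀` with `p ∤ a_{i₀}`, so that `a_{i₀}` is a unit of
`ℤ_p` (tree lemma `IwasawaDual.isUnit_natCast_padicInt`); for a target `t ∈ ℤ_p` joint
surjectivity gives `σ` with `Φ_{i₀}(σ) = a_{i₀}⁻¹ t` and `Φ_i(σ) = 0` for `i ≠ i₀`, whence
`κ σ = t`.  (2) `γ` is any preimage of `1` under the surjection `κ`.  (3) is entirely in the tree:
existence of the dual datum is `WeierstrassCurve.nonempty_selmerDualData_holds` (Greenberg, LNM 1716,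
§1, after Conj. 1.3), and its finite generation for EVERY `ℤ_p`-extension of a number field is
`WeierstrassCurve.SelmerDualData.module_finite_of_inertia_le` (dual Nakayama lemma + finiteness of
`Sel_∞[𝔪]`) fed with `ZpExtension.inertia_le_kerSubgroup_holds` (`ℤ_p`-extensions are unramified
outside `p`, Washington Prop. 13.2).

## References

* R. Greenberg, *Iwasawa theory for elliptic curves*, LNM 1716 (1999), §1 (p. 60, after Conj. 1.3;
  Thm. 1.3) [GreenbergLNM1716].
* L. Washington, *Introduction to Cyclotomic Fields*, 2nd ed. (1997), §13.1–13.2 [Washington1997].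
-/

-- `Summit.BirchSwinnertonDyer.BirchSwinnertonDyer` is the mandated summit-side namespace
-- (CONVENTIONS §2); the duplicate component is deliberate.
set_option linter.dupNamespace false

noncomputable section

open Field Literature.NumberTheory.EllipticCurves

namespace Summit.BirchSwinnertonDyer.BirchSwinnertonDyer.Theorems

/-- **The line character is a continuous homomorphism.** For continuous characters
`Φ_i : Γ_K →ₜ* ℤ_p` and `a ∈ ℕ^n` there is a continuous homomorphism `f : Γ_K →ₜ* ℤ_p` with
`f σ = ∑ aᵢ Φᵢ(σ)` for all `σ` (a finite `ℤ_p`-linear combination of continuous homomorphisms into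
the topological ring `ℤ_p`). [folklore] -/
private theorem exists_continuousMonoidHom_lineChar (K : Type) [Field K] (p : ℕ) [Fact p.Prime]
    (n : ℕ) (Φ : Fin n → (absoluteGaloisGroup K →ₜ* Multiplicative ℤ_[p])) (a : Fin n → ℕ) :
    ∃ f : absoluteGaloisGroup K →ₜ* Multiplicative ℤ_[p],
      ∀ σ, (f σ).toAdd = ∑ i, (a i : ℤ_[p]) * (Φ i σ).toAdd :=
  ⟨{ toFun := fun σ => Multiplicative.ofAdd (∑ i, (a i : ℤ_[p]) * (Φ i σ).toAdd)
     map_one' := by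
       simp only [map_one, toAdd_one, mul_zero, Finset.sum_const_zero, ofAdd_zero]
     map_mul' := fun σ τ => by
       simp only [map_mul, toAdd_mul, mul_add, Finset.sum_add_distrib, ofAdd_add]
     continuous_toFun := continuous_ofAdd.comp (continuous_finsetSum _ fun i _ =>
       continuous_const.mul (continuous_toAdd.comp (map_continuous (Φ i)))) },
    fun _ => rfl⟩

/-- **The line of an integral direction with a coordinate prime to `p` is a `ℤ_p`-extension.** If
the `Φ_i` are jointly surjective onto `ℤ_p^n` and `p ∤ a_{i₀}` for some `i₀`, the line character
`κ = ∑ aᵢ Φᵢ` is surjective: `a_{i₀} ∈ ℤ_pˣ` (`IwasawaDual.isUnit_natCast_padicInt`), and for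
`t ∈ ℤ_p` a `σ` with `Φ_{i₀}(σ) = a_{i₀}⁻¹ t`, `Φ_i(σ) = 0` (`i ≠ i₀`) has `κ σ = t`.
Washington, *Introduction to Cyclotomic Fields*, §13.1. [folklore] -/
private theorem exists_zpExtension_lineChar (K : Type) [Field K] (p : ℕ) [Fact p.Prime] (n : ℕ)
    (Φ : Fin n → (absoluteGaloisGroup K →ₜ* Multiplicative ℤ_[p])) (a : Fin n → ℕ)
    (hΦ : Function.Surjective (fun (σ : absoluteGaloisGroup K) (i : Fin n) => (Φ i σ).toAdd))
    (ha : ∃ i, ¬ p ∣ a i) :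
    ∃ κ : ZpExtension K p, ∀ σ, (κ σ).toAdd = ∑ i, (a i : ℤ_[p]) * (Φ i σ).toAdd := by
  obtain ⟨f, hf⟩ := exists_continuousMonoidHom_lineChar K p n Φ a
  obtain ⟨i₀, hi₀⟩ := ha
  obtain ⟨u, hu⟩ := IwasawaDual.isUnit_natCast_padicInt (p := p) hi₀
  refine ⟨⟨f, fun t => ?_⟩, hf⟩
  obtain ⟨σ, hσ⟩ := hΦ (Pi.single i₀ (((u⁻¹ : ℤ_[p]ˣ) : ℤ_[p]) * t.toAdd))
  have hσi : ∀ i,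
      (Φ i σ).toAdd = (Pi.single i₀ (((u⁻¹ : ℤ_[p]ˣ) : ℤ_[p]) * t.toAdd) : Fin n → ℤ_[p]) i :=
    fun i => congrFun hσ i
  refine ⟨σ, Multiplicative.toAdd.injective ?_⟩
  rw [hf, Finset.sum_eq_single i₀ (fun i _ hi => by rw [hσi i, Pi.single_eq_of_ne hi, mul_zero])
    (fun h => absurd (Finset.mem_univ i₀) h), hσi i₀, Pi.single_eq_same, ← hu,
    Units.mul_inv_cancel_left]

/-- Stub **P — LINE DATA** of line `heegner-leading-form-plectic-certificate` for the crux
`PlecticRankUB` (known; Greenberg, LNM 1716 §1 + Nakayama).  For a jointly surjective family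
`Φ : Γ_K → ℤ_p^n` of continuous characters of a number field `K` and an integral direction `a` with
some `p ∤ aᵢ`, the character `∑ aᵢ Φᵢ` is surjective, i.e. a `ℤ_p`-extension `κ` (the line of
direction `a`, `exists_zpExtension_lineChar`); it has a topological generator `γ` (a preimage of
`1`); and for every elliptic curve `W/K` the Pontryagin dual of `Sel_{p^∞}(W/K_∞)` carries a
`Λ`-module structure with `T = γ − 1` (`WeierstrassCurve.nonempty_selmerDualData_holds`) which is
finitely generated (`WeierstrassCurve.SelmerDualData.module_finite_of_inertia_le` with
`ZpExtension.inertia_le_kerSubgroup_holds`: `X/𝔪X` is dual to `Sel_∞[𝔪]`, finite for ANY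
`ℤ_p`-extension of a number field since such extensions are unramified outside `p`).
[cite: GreenbergLNM1716, §1 Thm. 1.3] -/
theorem stub_lineData :
    ∀ (K : Type) [Field K] [NumberField K] (p : ℕ) [Fact p.Prime] (n : ℕ)
      (Φ : Fin n → (absoluteGaloisGroup K →ₜ* Multiplicative ℤ_[p])) (a : Fin n → ℕ),
      Function.Surjective (fun (σ : absoluteGaloisGroup K) (i : Fin n) => (Φ i σ).toAdd) →
      (∃ i, ¬ p ∣ a i) →
        ∃ κ : ZpExtension K p, (∀ σ, (κ σ).toAdd = ∑ i, (a i : ℤ_[p]) * (Φ i σ).toAdd) ∧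
          ∃ γ : absoluteGaloisGroup K, κ.IsTopGenerator γ ∧
            ∀ (W : WeierstrassCurve K) [W.IsElliptic],
              ∃ D : W.SelmerDualData κ γ, Module.Finite (IwasawaAlgebra p) D.X := by
  intro K _ _ p _ n Φ a hΦ ha
  obtain ⟨κ, hκ⟩ := exists_zpExtension_lineChar K p n Φ a hΦ ha
  obtain ⟨γ, hγ⟩ := κ.surjective (Multiplicative.ofAdd 1)
  have hγ' : κ.IsTopGenerator γ := hγ
  refine ⟨κ, hκ, γ, hγ', fun W _ => ?_⟩
  obtain ⟨D⟩ := W.nonempty_selmerDualData_holds κ γ hγ'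
  exact ⟨D, WeierstrassCurve.SelmerDualData.module_finite_of_inertia_le W κ
    (ZpExtension.inertia_le_kerSubgroup_holds K p) D hγ'⟩

end Summit.BirchSwinnertonDyer.BirchSwinnertonDyer.Theorems

end
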